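import Mathlib
import Summits.AnomalousDissipation.AnomalousDissipation.Theorems.SoloBlindTailOperator

/-!
# SoloBlind — the fold identity for a chain with a dominant tail (J-TAIL, part 2)

Global tridiagonal rows `a j · x (j-1) - β j · x j + c j · x (j+1) = r j` (`j ≥ 0`), right-hand side supported
in the rows `≤ n` (the FOLD ROW is `n`), a SEED DEPTH `K = n + L + 1` beyond which the rows are dominant
(`SoloBlindTailOperator.Dominant` for the shifted coefficients), and tail values `t k`, `n+1 ≤ k ≤ K`, with
`t K = tval` (the seed, part 1) and the certified backward recursion `t k · (β k - c k · t (k+1)) = a k`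
(ENGINE L `tail_ball`, each step a zero-free inversion).  Then:

* `fold_isSol` / `fold_bounded` / `fold_top` — from a solution `z` of the FOLDED finite system (rows `< n` unchanged,
  row `n` with `β n ↦ β n - c n · t (n+1)`) the sequence `xsol` (`z` on the rows `≤ n`, then `z n · t (n+1) ⋯ t j`, then the
  scaled bounded tail solution) is a bounded solution of the infinite system whose top block is `z`;
* `fold_unique` — if the folded homogeneous system has only the trivial solution and the recursion denominators are
  nonzero, the infinite system has at most one bounded solution.

Hence the Green's entries of the bounded solution in the rows `≤ n` are exactly those of the folded finite matrix —
the identity behind every folded chain of ENGINE L (J-TAIL discharged structurally; the numerical inputs are the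
seed ball / seed Lipschitz constant of part 1 and the certified recursion).
-/

namespace Summit.AnomalousDissipation.SoloBlind.TailFold

open BoundedContinuousFunction Finset
open Summit.AnomalousDissipation.SoloBlind.TailOperator

variable {a β c : ℕ → ℂ} {b q : ℝ} {n L : ℕ}

/-- The candidate bounded solution built from the folded top solution `z`, the tail values `t` and the bounded tail
solution `y` at the seed depth `K = n + L + 1` (with `aK = a K`). -/
noncomputable def xsol (z t y : ℕ → ℂ) (aK : ℂ) (n L : ℕ) (j : ℕ) : ℂ :=
  if j ≤ n then z j
  else if j ≤ n + L then z n * ∏ i ∈ Icc (n + 1) j, t i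
  else z n * (∏ i ∈ Icc (n + 1) (n + L), t i) * (-aK) * y (j - (n + L + 1))

variable {z t y : ℕ → ℂ} {aK : ℂ}

/-- The top block of `xsol` is `z`. -/
theorem xsol_top {j : ℕ} (hj : j ≤ n) : xsol z t y aK n L j = z j := by
  simp [xsol, hj]

/-- The recursion block of `xsol`: `z n · ∏_{n<i≤j} t i`. -/
theorem xsol_mid {j : ℕ} (hj : n < j) (hj' : j ≤ n + L) :
    xsol z t y aK n L j = z n * ∏ i ∈ Icc (n + 1) j, t i := by
  simp [xsol, not_le.mpr hj, hj']

/-- The tail block of `xsol`: the scaled bounded tail solution. -/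
theorem xsol_tail (i : ℕ) :
    xsol z t y aK n L (n + L + 1 + i) = z n * (∏ i ∈ Icc (n + 1) (n + L), t i) * (-aK) * y i := by
  have h1 : ¬ (n + L + 1 + i ≤ n) := by omega
  have h2 : ¬ (n + L + 1 + i ≤ n + L) := by omega
  simp [xsol, h1, h2]

/-- `xsol (n+L) = z n · ∏_{n<i≤n+L} t i` (also for `L = 0`). -/
theorem xsol_last : xsol z t y aK n L (n + L) = z n * ∏ i ∈ Icc (n + 1) (n + L), t i := by
  rcases Nat.eq_zero_or_pos L with hL | hL
  · subst hL; simp [xsol]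
  · exact xsol_mid (by omega) le_rfl

/-- The multiplicative structure below the fold: `x (j+1) = x j · t (j+1)` for `n ≤ j ≤ n + L`, given the seed
identity `t (n+L+1) = -aK · y 0`. -/
theorem xsol_succ (htK : t (n + L + 1) = -aK * y 0) {j : ℕ} (hj : n ≤ j) (hj' : j ≤ n + L) :
    xsol z t y aK n L (j + 1) = xsol z t y aK n L j * t (j + 1) := by
  rcases eq_or_lt_of_le hj' with h | h
  · -- j = n + L : the seed row
    subst h
    have := xsol_tail (z := z) (t := t) (y := y) (aK := aK) (n := n) (L := L) 0
    rw [add_zero] at this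
    rw [this, xsol_last, htK]; ring
  · rw [xsol_mid (by omega) (by omega)]
    rcases eq_or_lt_of_le hj with h' | h'
    · subst h'; rw [xsol_top le_rfl]; simp
    · rw [xsol_mid h' hj', Finset.prod_Icc_succ_top (by omega)]; ring

/-- `prev xsol j = prev z j` on the rows `j ≤ n+1`. -/
theorem prev_xsol_of_le {j : ℕ} (hj : j ≤ n + 1) : prev (xsol z t y aK n L) j = prev z j := by
  cases j with
  | zero => rfl
  | succ i => simp [prev, xsol_top (show i ≤ n by omega)]

/-- **Fold, existence half**: `xsol` solves the infinite system. Hypotheses: the folded rows for `z`, the recursion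
identities `t k (β k - c k t (k+1)) = a k` for `n < k ≤ n+L`, the seed identity, and the tail system for `y` at depth
`K = n+L+1` with right-hand side `δ₀`; the right-hand side `r` vanishes below the fold row. -/
theorem fold_isSol {r : ℕ → ℂ}
    (hz : ∀ j, j < n → a j * prev z j - β j * z j + c j * z (j + 1) = r j)
    (hzf : a n * prev z n - (β n - c n * t (n + 1)) * z n = r n)
    (hr : ∀ j, n < j → r j = 0)
    (hrec : ∀ k, n < k → k ≤ n + L → t k * (β k - c k * t (k + 1)) = a k)
    (haK : aK = a (n + L + 1)) (htK : t (n + L + 1) = -aK * y 0)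
    (hy : IsSol (fun i => a (n + L + 1 + i)) (fun i => β (n + L + 1 + i)) (fun i => c (n + L + 1 + i))
      (fun i => if i = 0 then 1 else 0) y) :
    IsSol a β c r (xsol z t y aK n L) := by
  intro j
  rcases lt_trichotomy j n with hj | hj | hj
  · -- rows above the fold row
    rw [prev_xsol_of_le (by omega), xsol_top hj.le, xsol_top (by omega)]; exact hz j hj
  · -- the fold row
    subst hj
    rw [prev_xsol_of_le (by omega), xsol_top le_rfl, xsol_succ htK le_rfl (by omega), xsol_top le_rfl, ← hzf]; ring
  · rcases Nat.lt_or_ge (n + L) j with hj' | hj'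
    swap
    · -- recursion rows n < j ≤ n+L
      obtain ⟨i, rfl⟩ : ∃ i, j = i + 1 := ⟨j - 1, by omega⟩
      rw [hr _ hj, prev_succ, xsol_succ htK (by omega) hj', xsol_succ htK (by omega) (by omega)]
      have := hrec (i + 1) hj hj'
      linear_combination (xsol z t y aK n L i) * (-this)
    · -- tail rows j ≥ K
      obtain ⟨i, rfl⟩ : ∃ i, j = n + L + 1 + i := ⟨j - (n + L + 1), by omega⟩
      rw [hr _ (by omega)]
      cases i with
      | zero =>
        rw [add_zero, show n + L + 1 = (n + L) + 1 from rfl, prev_succ, xsol_last]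
        have h0 := hy 0
        simp only [prev_zero, mul_zero, zero_sub, if_true, zero_add] at h0
        have e1 : xsol z t y aK n L (n + L + 1) = z n * (∏ i ∈ Icc (n + 1) (n + L), t i) * (-aK) * y 0 := by
          have := xsol_tail (z := z) (t := t) (y := y) (aK := aK) (n := n) (L := L) 0; rwa [add_zero] at this
        have e2 : xsol z t y aK n L (n + L + 1 + 1) = z n * (∏ i ∈ Icc (n + 1) (n + L), t i) * (-aK) * y 1 :=
          xsol_tail 1
        rw [show n + L + 1 = n + L + 1 from rfl] at e1
        rw [e1, e2, haK]
        linear_combination (z n * (∏ i ∈ Icc (n + 1) (n + L), t i) * (-a (n + L + 1))) * h0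
      | succ i =>
        have hi := hy (i + 1)
        simp only [prev_succ, Nat.succ_ne_zero, if_false] at hi
        rw [show n + L + 1 + (i + 1) = (n + L + 1 + i) + 1 by omega, prev_succ, xsol_tail,
          show n + L + 1 + i + 1 + 1 = n + L + 1 + (i + 1 + 1) by omega,
          show n + L + 1 + i + 1 = n + L + 1 + (i + 1) by omega, xsol_tail, xsol_tail]
        linear_combination (z n * (∏ i ∈ Icc (n + 1) (n + L), t i) * (-aK)) * hi

/-- `xsol` is bounded when `y` is. -/
theorem fold_bounded {B : ℝ} (hB : ∀ i, ‖y i‖ ≤ B) : ∃ C, ∀ j, ‖xsol z t y aK n L j‖ ≤ C := by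
  refine ⟨(∑ j ∈ range (n + L + 1), ‖xsol z t y aK n L j‖) +
    ‖z n * (∏ i ∈ Icc (n + 1) (n + L), t i) * (-aK)‖ * B, fun j => ?_⟩
  have hB0 : 0 ≤ B := le_trans (norm_nonneg _) (hB 0)
  have hS : 0 ≤ ∑ j ∈ range (n + L + 1), ‖xsol z t y aK n L j‖ := sum_nonneg fun _ _ => norm_nonneg _
  have hT : 0 ≤ ‖z n * (∏ i ∈ Icc (n + 1) (n + L), t i) * (-aK)‖ * B := mul_nonneg (norm_nonneg _) hB0
  rcases Nat.lt_or_ge j (n + L + 1) with hj | hj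
  · have : ‖xsol z t y aK n L j‖ ≤ ∑ j ∈ range (n + L + 1), ‖xsol z t y aK n L j‖ :=
      single_le_sum (f := fun j => ‖xsol z t y aK n L j‖) (fun _ _ => norm_nonneg _) (mem_range.mpr hj)
    linarith
  · obtain ⟨i, rfl⟩ : ∃ i, j = n + L + 1 + i := ⟨j - (n + L + 1), by omega⟩
    rw [xsol_tail, norm_mul]
    have : ‖z n * (∏ i ∈ Icc (n + 1) (n + L), t i) * (-aK)‖ * ‖y i‖ ≤
        ‖z n * (∏ i ∈ Icc (n + 1) (n + L), t i) * (-aK)‖ * B := mul_le_mul_of_nonneg_left (hB i) (norm_nonneg _)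
    linarith

/-- The top block of `xsol` is `z`. -/
theorem fold_top {j : ℕ} (hj : j ≤ n) : xsol z t y aK n L j = z j := xsol_top hj

/-- **Fold, uniqueness half**: if the rows from the seed depth `K = n+L+1` are dominant, the recursion denominators
`β k - c k t (k+1)` (`n < k ≤ n+L`) are nonzero with `t k (β k - c k t(k+1)) = a k`, `t K = tval`, and the folded
homogeneous finite system has only the trivial solution, then two bounded solutions of the infinite system coincide. -/
theorem fold_unique {r : ℕ → ℂ}
    (hD : Dominant (fun i => a (n + L + 1 + i)) (fun i => β (n + L + 1 + i)) (fun i => c (n + L + 1 + i)) b q)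
    (htK : t (n + L + 1) = tval hD)
    (hden : ∀ k, n < k → k ≤ n + L → β k - c k * t (k + 1) ≠ 0)
    (hrec : ∀ k, n < k → k ≤ n + L → t k * (β k - c k * t (k + 1)) = a k)
    (hF : ∀ w : ℕ → ℂ, (∀ j, j < n → a j * prev w j - β j * w j + c j * w (j + 1) = 0) →
      a n * prev w n - (β n - c n * t (n + 1)) * w n = 0 → ∀ j, j ≤ n → w j = 0)
    {x x' : ℕ → ℂ} (hx : IsSol a β c r x) (hx' : IsSol a β c r x') {B B' : ℝ}
    (hB : ∀ j, ‖x j‖ ≤ B) (hB' : ∀ j, ‖x' j‖ ≤ B') : x = x' := by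
  -- the difference solves the homogeneous system and is bounded
  set d : ℕ → ℂ := fun j => x j - x' j with hd
  have hdS : IsSol a β c 0 d := by
    intro j; have e1 := hx j; have e2 := hx' j
    simp only [hd, ← prev_sub, Pi.zero_apply]; linear_combination e1 - e2
  have hdB : ∀ j, ‖d j‖ ≤ B + B' := fun j =>
    (norm_sub_le _ _).trans (add_le_add (hB j) (hB' j))
  -- Step 1: the tail from K is the scaled bounded tail solution, so d K = t K · d (K-1)
  set K := n + L + 1 with hK
  have hKpos : K - 1 = n + L := by omega
  let ρ : ℕ →ᵇ ℂ := (-(a K) * d (n + L)) • delta0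
  have hρ : ∀ i, ρ i = (-(a K) * d (n + L)) * (if i = 0 then 1 else 0) := fun i => by
    show (-(a K) * d (n + L)) • delta0 i = _; rw [delta0_apply, smul_eq_mul]
  have hdK : IsSol (fun i => a (K + i)) (fun i => β (K + i)) (fun i => c (K + i)) ρ (fun i => d (K + i)) := by
    intro i
    rw [hρ]
    cases i with
    | zero =>
      have := hdS K
      rw [hK, show n + L + 1 = (n + L) + 1 from rfl, prev_succ] at this
      simp only [prev_zero, mul_zero, zero_sub, add_zero, if_true, mul_one, Pi.zero_apply] at this ⊢
      rw [hK]; linear_combination this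
    | succ i =>
      have := hdS (K + i + 1)
      rw [prev_succ, Pi.zero_apply] at this
      simp only [prev_succ, Nat.succ_ne_zero, if_false, mul_zero]
      rw [show K + (i + 1) = K + i + 1 from rfl, show K + (i + 1 + 1) = K + i + 1 + 1 from rfl]
      linear_combination this
  have hscaled : IsSol (fun i => a (K + i)) (fun i => β (K + i)) (fun i => c (K + i)) ρ
      (fun i => (-(a K) * d (n + L)) * sol hD delta0 i) := by
    intro i
    have := isSol_sol hD delta0 i
    rw [hρ]
    have hp : prev (fun i => -a K * d (n + L) * (sol hD delta0) i) i = (-(a K) * d (n + L)) * prev (sol hD delta0) i := by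
      cases i <;> simp [prev]
    rw [hp]
    simp only [delta0_apply] at this
    linear_combination (-(a K) * d (n + L)) * this
  have e1 := eq_sol_of_isSol hD ρ hdK (B := B + B') (fun i => hdB (K + i))
  have e2 := eq_sol_of_isSol hD ρ hscaled (B := ‖-(a K) * d (n + L)‖ * ‖sol hD delta0‖)
    (fun i => by rw [norm_mul]; exact mul_le_mul_of_nonneg_left ((sol hD delta0).norm_coe_le_norm i) (norm_nonneg _))
  have htail : ∀ i, d (K + i) = (-(a K) * d (n + L)) * sol hD delta0 i := fun i => by
    have := congrFun (e1.trans e2.symm) i; simpa using this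
  have hstepK : d K = t K * d (n + L) := by
    have := htail 0; rw [add_zero] at this; rw [this, htK, tval]; ring
  -- Step 2: downward induction  d (n+1+i) = t (n+1+i) · d (n+i)  for i ≤ L
  have hdown : ∀ s i, i + s = L → d (n + 1 + i) = t (n + 1 + i) * d (n + i) := by
    intro s
    induction s with
    | zero => intro i hi; rw [add_zero] at hi; subst hi
              rw [show n + 1 + i = K by omega]; exact hstepK
    | succ s ih =>
      intro i hi
      have hnext := ih (i + 1) (by omega)
      have row := hdS (n + 1 + i)
      rw [show n + 1 + i = (n + i) + 1 by omega, prev_succ, Pi.zero_apply] at row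
      rw [show n + 1 + (i + 1) = n + i + 1 + 1 by omega, show n + (i + 1) = n + i + 1 by omega] at hnext
      have hk1 : n < n + i + 1 := by omega
      have hk2 : n + i + 1 ≤ n + L := by omega
      have hne := hden (n + i + 1) hk1 hk2
      have htk := hrec (n + i + 1) hk1 hk2
      rw [show n + 1 + i = n + i + 1 by omega]
      rw [hnext] at row
      -- row : a * d(n+i) - β * d k + c * (t(k+1) * d k) = 0
      have hmul : d (n + i + 1) * (β (n + i + 1) - c (n + i + 1) * t (n + i + 1 + 1)) = a (n + i + 1) * d (n + i) := by
        linear_combination -row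
      apply mul_right_cancel₀ hne
      rw [hmul]
      linear_combination (-(d (n + i))) * htk
  have hstep : ∀ i, i ≤ L → d (n + 1 + i) = t (n + 1 + i) * d (n + i) := fun i hi => hdown (L - i) i (by omega)
  -- Step 3: the top block solves the folded homogeneous system, hence vanishes
  have htop : ∀ j, j ≤ n → d j = 0 := by
    refine hF d (fun j hj => by have := hdS j; simpa using this) ?_
    have row := hdS n
    have h01 := hstep 0 (Nat.zero_le _)
    rw [add_zero, add_zero] at h01
    simp only [Pi.zero_apply] at row
    rw [h01] at row
    linear_combination row
  -- Step 4: everything vanishes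
  have hmid : ∀ i, i ≤ L → d (n + 1 + i) = 0 := by
    intro i
    induction i with
    | zero => intro _; rw [hstep 0 (Nat.zero_le _)]; simp only [add_zero]; rw [htop n le_rfl, mul_zero]
    | succ i ih => intro hi; rw [hstep (i + 1) hi, show n + (i + 1) = n + 1 + i by omega, ih (by omega), mul_zero]
  have hnL : d (n + L) = 0 := by
    rcases Nat.eq_zero_or_pos L with hL | hL
    · rw [hL, add_zero]; exact htop n le_rfl
    · have := hmid (L - 1) (by omega); rwa [show n + 1 + (L - 1) = n + L by omega] at this
  funext j
  have : d j = 0 := by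
    rcases Nat.lt_or_ge n j with hj | hj
    swap
    · exact htop j hj
    rcases Nat.lt_or_ge (n + L) j with hj' | hj'
    swap
    · have := hmid (j - (n + 1)) (by omega); rwa [show n + 1 + (j - (n + 1)) = j by omega] at this
    · obtain ⟨i, rfl⟩ : ∃ i, j = K + i := ⟨j - K, by omega⟩
      rw [htail i, hnL]; ring
  simpa [hd, sub_eq_zero] using this

end Summit.AnomalousDissipation.SoloBlind.TailFold
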